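import Summits.RiemannHypothesis.RiemannHypothesis.Theorems.SpectralTraceFloorFeedbackDefs
import Summits.RiemannHypothesis.RiemannHypothesis.Theorems.SpectralTraceWindowStepStubHighZone
import Literature.NumberTheory.LFunctions.RiemannSiegelThetaBounds
import Mathlib.Analysis.Fourier.RiemannLebesgueLemma
import Mathlib.MeasureTheory.Integral.IntervalIntegral.FundThmCalculus
import Mathlib.MeasureTheory.Integral.Bochner.ContinuousLinearMap
import Mathlib.Analysis.SpecificLimits.Basic
import HarnessLib

/-!
# Regularity and density floor of the explicit window density `ρ_A` (`stub_modelRegular`)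

Route `SpectralTrace`, crux `WindowStep` (stmt-RiemannHypothesis-14659), line `floor-feedback`, stub
`stub_modelRegular` (K0b). RH-free real analysis about the explicit model of the window `[-A, A]`
(definitions `Theorems/SpectralTraceFloorFeedbackDefs.lean`):
`ρ_A(T) = θ′(T)/π + p_A(T) − (1/π) Σ_{log m < A} Λ(m) m^{-1/2} cos(T log m)`,
`p_A(T) = (1/2π) ∫ 2cosh(t/2) χ_A(t) cos(tT) dt`, `Φ_A(T) = ∫₀ᵀ ρ_A`,
`C⋆(A) = log(2π)/(2π) + M(A)/π + 1/10`, `floorHeight A = inf {T₀ ≥ 1 : floor from T₀ on}`.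

**Statement.** `ρ_A` is continuous, `Φ_A′ = ρ_A`, `|ρ_A(T)| ≤ C log(2 + |T|)`, `floorHeight A ≥ 1` and
`ρ_A(T) ≥ (1/2π) log|T| − C⋆(A)` for `|T| ≥ floorHeight A`.

**Proof.** (i) `θ′` is continuous (`continuous_riemannSiegelThetaDeriv_holds`); `p_A` is `(1/2π) Re 𝓕F(T/2π)`
for the integrable `F = 2cosh(·/2) χ_A`, hence continuous and bounded by `(1/2π)‖F‖₁`, and `p_A(T) → 0`
(Riemann–Lebesgue, `Real.zero_at_infty_fourier`); the cosine sum is a finite sum of continuous functions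
bounded by `M(A)`. (ii) FTC for the continuous integrand. (iii) `|θ′(u) − ½ log(u/2π)| ≤ 2/u` for
`u ≥ 1` (`abs_riemannSiegelThetaDeriv_sub_log_le`) and evenness give `|θ′(T)| ≤ ½ log(2+|T|) + O(1)` for
`|T| ≥ 1`, continuity bounds `θ′` on `[-1, 1]`, and `log(2 + |T|) ≥ log 2 > 1/2` absorbs the constants.
(iv)–(v) The same Stirling bound gives `θ′(T)/π ≥ (1/2π) log|T| − log(2π)/(2π) − 2/(π|T|)`, so the floor
holds as soon as `2/|T| ≤ 1/10` and `|p_A(T)| ≤ 1/20`, i.e. the floor set is non-empty; it is an up-ray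
whose infimum belongs to it by continuity of both sides (limit along `T(1 + 1/(n+1)) → T`). [folklore]
-/

set_option linter.dupNamespace false

noncomputable section

open Complex Filter Set MeasureTheory
open scoped Real Topology BigOperators FourierTransform SchwartzMap

namespace Summit.RiemannHypothesis.RiemannHypothesis.Theorems.SpectralTraceWindowStep

open Literature.NumberTheory.LFunctions
open Summit.RiemannHypothesis.RiemannHypothesis.Theorems.FloorFeedback

/-! ## The cosine transform of an integrable function -/

/-- For an integrable real `F`, the cosine transform `∫ F(t) cos(tT) dt` is the real part of the
Fourier transform `𝓕F` (Mathlib normalisation `∫ F(v) e^{-2πivw} dv`) at `w = T/2π`. [folklore] -/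
theorem stub_modelRegular_cos_eq_re_fourier {F : ℝ → ℝ} (hF : Integrable F) (T : ℝ) :
    ∫ t : ℝ, F t * Real.cos (t * T) = (𝓕 (fun t : ℝ => (F t : ℂ)) (T / (2 * π))).re := by
  have hFc : Integrable (fun t : ℝ => (F t : ℂ)) := hF.ofReal
  have hi := (Real.fourierIntegral_convergent_iff (μ := volume) (f := fun t : ℝ => (F t : ℂ))
    (T / (2 * π))).2 hFc
  rw [Real.fourier_eq, ← RCLike.re_to_complex, ← integral_re hi]
  congr 1
  funext t
  rw [Circle.smul_def, Real.fourierChar_apply, smul_eq_mul, RCLike.re_to_complex,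
    Complex.re_mul_ofReal, Complex.exp_ofReal_mul_I_re, RCLike.inner_apply, conj_trivial]
  have : 2 * π * -(T / (2 * π) * t) = -(t * T) := by field_simp
  rw [this, Real.cos_neg, mul_comm]

/-- Riemann–Lebesgue in threshold form: `‖𝓕F(w)‖ ≤ ε` for `|w|` large. [folklore] -/
theorem stub_modelRegular_fourier_small (F : ℝ → ℝ) {ε : ℝ} (hε : 0 < ε) :
    ∃ R : ℝ, ∀ w : ℝ, R ≤ |w| → ‖𝓕 (fun t : ℝ => (F t : ℂ)) w‖ ≤ ε := by
  have h := Real.zero_at_infty_fourier (fun t : ℝ => (F t : ℂ))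
  have hev : ∀ᶠ w in cocompact ℝ, ‖𝓕 (fun t : ℝ => (F t : ℂ)) w‖ < ε := by
    have := (Metric.tendsto_nhds.1 h) ε hε
    simpa [dist_zero_right] using this
  obtain ⟨K, hK, hKp⟩ := (Filter.hasBasis_cocompact.eventually_iff).1 hev
  obtain ⟨r, hr⟩ := (Metric.isBounded_iff_subset_closedBall 0).1 hK.isBounded
  refine ⟨r + 1, fun w hw => le_of_lt (hKp ?_)⟩
  intro hwK
  have := hr hwK
  rw [Metric.mem_closedBall, Real.dist_eq, sub_zero] at this
  linarith

/-- The cosine transform `T ↦ ∫ F(t) cos(tT) dt` of an integrable real `F` is continuous, bounded by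
`‖F‖₁`, and tends to `0` as `|T| → ∞` (Riemann–Lebesgue). [folklore] -/
theorem stub_modelRegular_cosTransform {F : ℝ → ℝ} (hF : Integrable F) :
    Continuous (fun T : ℝ => ∫ t : ℝ, F t * Real.cos (t * T)) ∧
    (∀ T : ℝ, |∫ t : ℝ, F t * Real.cos (t * T)| ≤ ∫ t : ℝ, |F t|) ∧
    ∀ ε : ℝ, 0 < ε → ∃ R : ℝ, ∀ T : ℝ, R ≤ |T| → |∫ t : ℝ, F t * Real.cos (t * T)| ≤ ε := by
  have key : (fun T : ℝ => ∫ t : ℝ, F t * Real.cos (t * T)) =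
      fun T => (𝓕 (fun t : ℝ => (F t : ℂ)) (T / (2 * π))).re :=
    funext (stub_modelRegular_cos_eq_re_fourier hF)
  have hcF : Continuous (𝓕 (fun t : ℝ => (F t : ℂ))) :=
    VectorFourier.fourierIntegral_continuous Real.continuous_fourierChar
      (innerSL ℝ).continuous₂ hF.ofReal
  have hnorm : ∀ w : ℝ, ‖𝓕 (fun t : ℝ => (F t : ℂ)) w‖ ≤ ∫ t, |F t| := fun w => by
    refine (VectorFourier.norm_fourierIntegral_le_integral_norm _ _ _ _ _).trans (le_of_eq ?_)
    simp
  refine ⟨?_, fun T => ?_, fun ε hε => ?_⟩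
  · rw [key]
    exact Complex.continuous_re.comp (hcF.comp (continuous_id.div_const _))
  · rw [stub_modelRegular_cos_eq_re_fourier hF]
    exact (Complex.abs_re_le_norm _).trans (hnorm _)
  · obtain ⟨R, hR⟩ := stub_modelRegular_fourier_small F hε
    refine ⟨2 * π * R, fun T hT => ?_⟩
    rw [stub_modelRegular_cos_eq_re_fourier hF]
    refine (Complex.abs_re_le_norm _).trans (hR _ ?_)
    rw [abs_div, abs_of_pos (by positivity : (0 : ℝ) < 2 * π), le_div_iff₀ (by positivity)]
    linarith

/-! ## The polar kernel -/

/-- The polar kernel `p_A = (1/2π) ×` the cosine transform of the continuous compactly supported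
`t ↦ 2cosh(t/2) χ_A(t)`: it is continuous, bounded, and `|p_A(T)| ≤ 1/20` for `|T|` large. [folklore] -/
theorem stub_modelRegular_polar (A : ℝ) :
    Continuous (polarKernel A) ∧ (∃ c : ℝ, ∀ T : ℝ, |polarKernel A T| ≤ c) ∧
      ∃ R : ℝ, ∀ T : ℝ, R ≤ |T| → |polarKernel A T| ≤ 1 / 20 := by
  set F : ℝ → ℝ := fun t => 2 * Real.cosh (t / 2) * windowCutoff A t with hF
  have hFc : Continuous F := by
    have h1 : Continuous fun t : ℝ => 2 * Real.cosh (t / 2) := by fun_prop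
    exact h1.mul (windowCutoff A).continuous
  have hFs : HasCompactSupport F := (windowCutoff A).hasCompactSupport.mul_left
  have hFi : Integrable F := hFc.integrable_of_hasCompactSupport hFs
  obtain ⟨hc, hb, hd⟩ := stub_modelRegular_cosTransform hFi
  have hp : polarKernel A = fun T => 1 / (2 * π) * ∫ t : ℝ, F t * Real.cos (t * T) := by
    funext T
    rfl
  have hπ : 0 < 1 / (2 * π) := by positivity
  have hπ1 : 1 / (2 * π) ≤ 1 := by
    rw [div_le_one (by positivity)]
    linarith [Real.pi_gt_three]
  refine ⟨?_, ⟨1 / (2 * π) * ∫ t, |F t|, fun T => ?_⟩, ?_⟩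
  · rw [hp]
    exact continuous_const.mul hc
  · rw [hp]
    dsimp only
    rw [abs_mul, abs_of_pos hπ]
    exact mul_le_mul_of_nonneg_left (hb T) hπ.le
  · obtain ⟨R, hR⟩ := hd (1 / 20) (by norm_num)
    refine ⟨R, fun T hT => ?_⟩
    rw [hp]
    dsimp only
    rw [abs_mul, abs_of_pos hπ]
    calc 1 / (2 * π) * |∫ t, F t * Real.cos (t * T)| ≤ 1 / (2 * π) * (1 / 20) :=
          mul_le_mul_of_nonneg_left (hR T hT) hπ.le
      _ ≤ 1 * (1 / 20) := by gcongr
      _ = 1 / 20 := one_mul _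

/-! ## Bounds for `θ′` -/

/-- `log 2 > 1/2`, so `1 ≤ 2 log(2 + |T|)`. [folklore] -/
theorem stub_modelRegular_one_le_two_mul_log (T : ℝ) : 1 ≤ 2 * Real.log (2 + |T|) := by
  have h2 : Real.log 2 ≤ Real.log (2 + |T|) :=
    Real.log_le_log two_pos (by linarith [abs_nonneg T])
  have := Real.log_two_gt_d9
  linarith

/-- Lower Stirling bound: `θ′(T) ≥ ½ log|T| − ½ log(2π) − 2/|T|` for `|T| ≥ 1`
(`abs_riemannSiegelThetaDeriv_sub_log_le` and evenness of `θ′`). [folklore] -/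
theorem stub_modelRegular_thetaDeriv_lower {T : ℝ} (hT : 1 ≤ |T|) :
    Real.log |T| / 2 - Real.log (2 * π) / 2 - 2 / |T| ≤ riemannSiegelThetaDeriv T := by
  have h := (abs_le.1 (abs_riemannSiegelThetaDeriv_sub_log_le hT)).1
  rw [stub_highZone_thetaDeriv_abs, Real.log_div (show (|T| : ℝ) ≠ 0 by positivity)
    (by positivity : (2 : ℝ) * π ≠ 0)] at h
  linarith

/-- `|θ′(T)| ≤ ½ log(2 + |T|) + (½ log(2π) + 2)` for `|T| ≥ 1`. [folklore] -/
theorem stub_modelRegular_thetaDeriv_abs_le {T : ℝ} (hT : 1 ≤ |T|) :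
    |riemannSiegelThetaDeriv T| ≤ Real.log (2 + |T|) / 2 + (Real.log (2 * π) / 2 + 2) := by
  have h := abs_le.1 (abs_riemannSiegelThetaDeriv_sub_log_le hT)
  rw [stub_highZone_thetaDeriv_abs, Real.log_div (show (|T| : ℝ) ≠ 0 by positivity)
    (by positivity : (2 : ℝ) * π ≠ 0)] at h
  have hlog0 : 0 ≤ Real.log |T| := Real.log_nonneg hT
  have hlog1 : Real.log |T| ≤ Real.log (2 + |T|) := Real.log_le_log (by linarith) (by linarith)
  have h2T : 2 / |T| ≤ 2 := div_le_self (by norm_num) hT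
  have hl2π : 0 ≤ Real.log (2 * π) := Real.log_nonneg (by linarith [Real.pi_gt_three])
  rw [abs_le]
  constructor <;> linarith [h.1, h.2]

/-- `θ′(T) = O(log(2 + |T|))` with an explicit constant: Stirling for `|T| ≥ 1`, continuity of `θ′` on
`[-1, 1]`. [folklore] -/
theorem stub_modelRegular_thetaDeriv_bound :
    ∃ c : ℝ, ∀ T : ℝ, |riemannSiegelThetaDeriv T| ≤ c * Real.log (2 + |T|) := by
  have hcont : Continuous riemannSiegelThetaDeriv := continuous_riemannSiegelThetaDeriv_holds
  obtain ⟨K, hK⟩ :=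
    isCompact_Icc.exists_bound_of_continuousOn (hcont.continuousOn (s := Icc (-1 : ℝ) 1))
  refine ⟨2 * max K 0 + (1 + 2 * (Real.log (2 * π) / 2 + 2)), fun T => ?_⟩
  have hL := stub_modelRegular_one_le_two_mul_log T
  have hL0 : 0 ≤ Real.log (2 + |T|) := by linarith
  have hK0 : 0 ≤ max K 0 := le_max_right _ _
  have hl2π : 0 ≤ Real.log (2 * π) / 2 + 2 := by
    have := Real.log_nonneg (show (1 : ℝ) ≤ 2 * π by linarith [Real.pi_gt_three])
    linarith
  have e1 : max K 0 ≤ max K 0 * (2 * Real.log (2 + |T|)) := le_mul_of_one_le_right hK0 hL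
  have e2 : Real.log (2 * π) / 2 + 2 ≤ (Real.log (2 * π) / 2 + 2) * (2 * Real.log (2 + |T|)) :=
    le_mul_of_one_le_right hl2π hL
  rcases le_or_gt 1 |T| with hT | hT
  · have := stub_modelRegular_thetaDeriv_abs_le hT
    linarith
  · have hmem : T ∈ Icc (-1 : ℝ) 1 := ⟨(abs_lt.1 hT).1.le, (abs_lt.1 hT).2.le⟩
    have hθ : |riemannSiegelThetaDeriv T| ≤ max K 0 := by
      have := hK T hmem
      rw [Real.norm_eq_abs] at this
      exact this.trans (le_max_left _ _)
    linarith

/-! ## The explicit density: continuity, FTC, `O(log)` -/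

/-- The cosine sum is at most `M = Σ Λ(m)/√m` in absolute value. [folklore] -/
theorem stub_modelRegular_abs_sum_le (S : Finset ℕ) (t : ℝ) :
    |∑ m ∈ S, (ArithmeticFunction.vonMangoldt m : ℝ) / Real.sqrt m * Real.cos (t * Real.log m)| ≤
      ∑ m ∈ S, (ArithmeticFunction.vonMangoldt m : ℝ) / Real.sqrt m := by
  refine (Finset.abs_sum_le_sum_abs _ _).trans (Finset.sum_le_sum fun m _ => ?_)
  rw [abs_mul, abs_of_nonneg (stub_highZone_weight_nonneg m)]
  exact mul_le_of_le_one_right (stub_highZone_weight_nonneg m) (Real.abs_cos_le_one _)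

/-- `ρ_A` is continuous. [folklore] -/
theorem stub_modelRegular_continuous (A : ℝ) : Continuous (modelDensity A) := by
  have hθ : Continuous riemannSiegelThetaDeriv := continuous_riemannSiegelThetaDeriv_holds
  have hp : Continuous (polarKernel A) := (stub_modelRegular_polar A).1
  have hs : Continuous fun T : ℝ => ∑ m ∈ weilPrimeIndex (A / 2),
      (ArithmeticFunction.vonMangoldt m : ℝ) / Real.sqrt m * Real.cos (T * Real.log m) := by
    fun_prop
  have e : modelDensity A = fun T => riemannSiegelThetaDeriv T / π + polarKernel A T -
      1 / π * ∑ m ∈ weilPrimeIndex (A / 2),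
        (ArithmeticFunction.vonMangoldt m : ℝ) / Real.sqrt m * Real.cos (T * Real.log m) := rfl
  rw [e]
  exact ((hθ.div_const _).add hp).sub (continuous_const.mul hs)

/-- `Φ_A′ = ρ_A` (fundamental theorem of calculus for the continuous integrand). [folklore] -/
theorem stub_modelRegular_hasDerivAt (A T : ℝ) : HasDerivAt (modelCount A) (modelDensity A T) T :=
  ((stub_modelRegular_continuous A).integral_hasStrictDerivAt 0 T).hasDerivAt

/-- `|ρ_A(T)| ≤ C log(2 + |T|)`. [folklore] -/
theorem stub_modelRegular_bigO (A : ℝ) :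
    ∃ C : ℝ, ∀ T : ℝ, |modelDensity A T| ≤ C * Real.log (2 + |T|) := by
  obtain ⟨c₁, hc₁⟩ := stub_modelRegular_thetaDeriv_bound
  obtain ⟨c₂, hc₂⟩ := (stub_modelRegular_polar A).2.1
  have hc₂0 : 0 ≤ c₂ := (abs_nonneg _).trans (hc₂ 0)
  have hM0 : 0 ≤ primeMass A := Finset.sum_nonneg fun m _ => stub_highZone_weight_nonneg m
  have hπ : 0 < π := Real.pi_pos
  refine ⟨c₁ / π + 2 * (c₂ + primeMass A / π), fun T => ?_⟩
  have hL := stub_modelRegular_one_le_two_mul_log T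
  have htri : |modelDensity A T| ≤
      |riemannSiegelThetaDeriv T| / π + |polarKernel A T| + primeMass A / π := by
    unfold modelDensity primeMass
    set θ := riemannSiegelThetaDeriv T
    set p := polarKernel A T
    set s := ∑ m ∈ weilPrimeIndex (A / 2),
      (ArithmeticFunction.vonMangoldt m : ℝ) / Real.sqrt m * Real.cos (T * Real.log m)
    have hs : |s| ≤ ∑ m ∈ weilPrimeIndex (A / 2), (ArithmeticFunction.vonMangoldt m : ℝ) / Real.sqrt m :=
      stub_modelRegular_abs_sum_le _ _
    calc |θ / π + p - 1 / π * s| ≤ |θ / π + p| + |1 / π * s| := abs_sub _ _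
      _ ≤ |θ / π| + |p| + |1 / π * s| := add_le_add (abs_add_le _ _) le_rfl
      _ = |θ| / π + |p| + 1 / π * |s| := by
          rw [abs_div, abs_of_pos hπ, abs_mul, abs_of_pos (by positivity : (0 : ℝ) < 1 / π)]
      _ ≤ |θ| / π + |p| + 1 / π * ∑ m ∈ weilPrimeIndex (A / 2),
            (ArithmeticFunction.vonMangoldt m : ℝ) / Real.sqrt m := by gcongr
      _ = _ := by ring
  have h1 : |riemannSiegelThetaDeriv T| / π ≤ c₁ * Real.log (2 + |T|) / π :=
    div_le_div_of_nonneg_right (hc₁ T) hπ.le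
  have h2 : c₂ + primeMass A / π ≤ (c₂ + primeMass A / π) * (2 * Real.log (2 + |T|)) :=
    le_mul_of_one_le_right (by positivity) hL
  have h3 := hc₂ T
  calc |modelDensity A T|
      ≤ |riemannSiegelThetaDeriv T| / π + |polarKernel A T| + primeMass A / π := htri
    _ ≤ c₁ * Real.log (2 + |T|) / π + (c₂ + primeMass A / π) * (2 * Real.log (2 + |T|)) := by
        linarith
    _ = (c₁ / π + 2 * (c₂ + primeMass A / π)) * Real.log (2 + |T|) := by ring

/-! ## The density floor -/

/-- `π ρ_A(T) = θ′(T) + π p_A(T) − Σ Λ(m) m^{-1/2} cos(T log m)`. [folklore] -/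
theorem stub_modelRegular_pi_mul_density (A T : ℝ) :
    π * modelDensity A T = riemannSiegelThetaDeriv T + π * polarKernel A T -
      ∑ m ∈ weilPrimeIndex (A / 2),
        (ArithmeticFunction.vonMangoldt m : ℝ) / Real.sqrt m * Real.cos (T * Real.log m) := by
  unfold modelDensity
  have hπ : (π : ℝ) ≠ 0 := Real.pi_ne_zero
  field_simp

/-- `π ((1/2π) log|T| − C⋆(A)) = ½ log|T| − ½ log(2π) − M(A) − π/10`. [folklore] -/
theorem stub_modelRegular_pi_mul_floor (A T : ℝ) :
    π * (Real.log |T| / (2 * π) - floorConst A) =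
      Real.log |T| / 2 - Real.log (2 * π) / 2 - primeMass A - π / 10 := by
  unfold floorConst
  have hπ : (π : ℝ) ≠ 0 := Real.pi_ne_zero
  field_simp
  ring

/-- The floor set is non-empty: the floor holds from `max R 20` on, where `|p_A| ≤ 1/20` beyond `R`.
[folklore] -/
theorem stub_modelRegular_floor_nonempty (A : ℝ) :
    ∃ T₀ : ℝ, 1 ≤ T₀ ∧ DensityFloor (modelDensity A) T₀ (floorConst A) := by
  obtain ⟨R, hR⟩ := (stub_modelRegular_polar A).2.2
  refine ⟨max R 20, le_max_of_le_right (by norm_num), fun T hT => ?_⟩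
  have hTR : R ≤ |T| := (le_max_left _ _).trans hT
  have hT20 : 20 ≤ |T| := (le_max_right _ _).trans hT
  have hT1 : 1 ≤ |T| := by linarith
  have hT0 : 0 < |T| := by linarith
  have hπ : 0 < π := Real.pi_pos
  have hπ3 := Real.pi_gt_three
  have hθ := stub_modelRegular_thetaDeriv_lower hT1
  have hp : -(1 / 20) ≤ polarKernel A T := (abs_le.1 (hR T hTR)).1
  have hp' := mul_le_mul_of_nonneg_left hp hπ.le
  have hs := stub_highZone_sum_le (weilPrimeIndex (A / 2)) T
  have h2T : 2 / |T| ≤ 1 / 10 := by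
    rw [div_le_iff₀ hT0]
    linarith
  refine le_of_mul_le_mul_left ?_ hπ
  rw [stub_modelRegular_pi_mul_floor, stub_modelRegular_pi_mul_density]
  unfold primeMass
  linarith

/-- The infimum of a non-empty floor set `{T₀ ≥ 1 : ρ(T) ≥ (1/2π) log|T| − C for |T| ≥ T₀}` of a
continuous `ρ` is at least `1` and belongs to the set (both sides of the floor inequality are continuous
at `T ≠ 0`; approximate `T` by `T(1 + 1/(n+1))`). [folklore] -/
theorem stub_modelRegular_sInf_floor {ρ : ℝ → ℝ} (hρ : Continuous ρ) (C : ℝ) {T₁ : ℝ} (h₁ : 1 ≤ T₁)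
    (hT₁ : ∀ T : ℝ, T₁ ≤ |T| → Real.log |T| / (2 * π) - C ≤ ρ T) :
    1 ≤ sInf {T₀ : ℝ | 1 ≤ T₀ ∧ ∀ T : ℝ, T₀ ≤ |T| → Real.log |T| / (2 * π) - C ≤ ρ T} ∧
    ∀ T : ℝ, sInf {T₀ : ℝ | 1 ≤ T₀ ∧ ∀ T : ℝ, T₀ ≤ |T| → Real.log |T| / (2 * π) - C ≤ ρ T} ≤ |T| →
      Real.log |T| / (2 * π) - C ≤ ρ T := by
  set S := {T₀ : ℝ | 1 ≤ T₀ ∧ ∀ T : ℝ, T₀ ≤ |T| → Real.log |T| / (2 * π) - C ≤ ρ T} with hS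
  have hne : S.Nonempty := ⟨T₁, h₁, hT₁⟩
  have h1 : 1 ≤ sInf S := le_csInf hne fun b hb => hb.1
  refine ⟨h1, fun T hT => ?_⟩
  have key : ∀ y : ℝ, sInf S < |y| → Real.log |y| / (2 * π) - C ≤ ρ y := fun y hy => by
    obtain ⟨T₀, hT₀S, hT₀y⟩ := exists_lt_of_csInf_lt hne hy
    exact hT₀S.2 y hT₀y.le
  have hT0 : 0 < |T| := lt_of_lt_of_le one_pos (h1.trans hT)
  have hTne : T ≠ 0 := abs_pos.1 hT0
  -- approximate `T` by `u n = T (1 + 1/(n+1))`, for which `|u n| > |T| ≥ sInf S`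
  have hu_tend : Tendsto (fun n : ℕ => T * (1 + 1 / ((n : ℝ) + 1))) atTop (𝓝 T) := by
    have := ((tendsto_one_div_add_atTop_nhds_zero_nat (𝕜 := ℝ)).const_add 1).const_mul T
    simpa using this
  have hu_gt : ∀ n : ℕ, sInf S < |T * (1 + 1 / ((n : ℝ) + 1))| := fun n => by
    have hpos : 0 < 1 / ((n : ℝ) + 1) := by positivity
    rw [abs_mul, abs_of_pos (by positivity : (0 : ℝ) < 1 + 1 / ((n : ℝ) + 1))]
    nlinarith
  have hlim1 : Tendsto (fun n : ℕ => Real.log |T * (1 + 1 / ((n : ℝ) + 1))| / (2 * π) - C) atTop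
      (𝓝 (Real.log |T| / (2 * π) - C)) := by
    have hc : ContinuousAt (fun y : ℝ => Real.log |y| / (2 * π) - C) T :=
      ((continuous_abs.continuousAt.log hT0.ne').div_const _).sub continuousAt_const
    exact hc.tendsto.comp hu_tend
  have hlim2 : Tendsto (fun n : ℕ => ρ (T * (1 + 1 / ((n : ℝ) + 1)))) atTop (𝓝 (ρ T)) :=
    (hρ.tendsto T).comp hu_tend
  exact le_of_tendsto_of_tendsto' hlim1 hlim2 fun n => key _ (hu_gt n)

/-- `floorHeight A ≥ 1` and the floor holds from `floorHeight A` on. [folklore] -/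
theorem stub_modelRegular_floor (A : ℝ) :
    1 ≤ floorHeight A ∧ DensityFloor (modelDensity A) (floorHeight A) (floorConst A) := by
  obtain ⟨T₀, hT₀, hfl⟩ := stub_modelRegular_floor_nonempty A
  unfold floorHeight DensityFloor
  exact stub_modelRegular_sInf_floor (stub_modelRegular_continuous A) (floorConst A) hT₀ hfl

/-- **stub_modelRegular (K0b, line `floor-feedback`, crux `WindowStep`).** The explicit window density
`ρ_A` is continuous, is the derivative of the model count `Φ_A`, is `O(log(2 + |T|))`, and satisfies the
floor `ρ_A(T) ≥ (1/2π) log|T| − C⋆(A)` from the height `floorHeight A ≥ 1` on. [folklore] -/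
theorem stub_modelRegular : ∀ A : ℝ, Continuous (modelDensity A) ∧ (∀ T : ℝ, HasDerivAt (modelCount A) (modelDensity A T) T) ∧ (∃ C : ℝ, ∀ T : ℝ, |modelDensity A T| ≤ C * Real.log (2 + |T|)) ∧ 1 ≤ floorHeight A ∧ DensityFloor (modelDensity A) (floorHeight A) (floorConst A) :=
  fun A => ⟨stub_modelRegular_continuous A, stub_modelRegular_hasDerivAt A, stub_modelRegular_bigO A,
    stub_modelRegular_floor A⟩

end Summit.RiemannHypothesis.RiemannHypothesis.Theorems.SpectralTraceWindowStep

end
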